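import Literature.Probability.Percolation.SlabRSWGluingBound
import Literature.Probability.Percolation.SlabRSWGluingRouteB
import Literature.Probability.Percolation.SlabRSWGluingRect
import HarnessLib

/-!
# Newman–Tassion–Wu 2017, §3.2 — GL0 (linear regime) with a SEGMENT target

Topic: `Literature/Probability/Percolation`. The files `SlabRSWGluingGeometry/Linear/Rect.lean`
prove NTW's gluing lemma GL0 (Thm. 3.6) in the linear regime for a rectangle `S = [a,b] × [c,d]`
whose target set `B` is a FULL side. All uses of GL0 in §3.3 (Prop. 3.9: the half-sides `X`, `Y`;
Thm. 3.14, Case 1: the segments `Z_i`) have `B` a proper SEGMENT `{b} × [y₁, y₂]` of a side. Then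
the minimal path `Γ` may run along the side line `x = b` outside `B`, and a contact of the
`C`-cluster near the end of `B` forces a local modification whose cleared box contains vertices
of `B̄`: the rerouted trunk is then ended AT a chosen vertex `β ∈ B̄` (`GlueData.SurgeryB`,
`SlabRSWGluingCoreB.lean`). This file constructs the four local modifications for a segment
target and derives GL0:

* `SegSetup` — `S = [a,b] × [c,d]`, `B = {b} × [y₁, y₂]` with `y₁ < y₂`, `A, C ⊆ S`.
* `SegSetup.R` — the radius of the cleared box at a contact point `z`: `ρ + 2`, enlarged to
  `ρ + 3` when exactly one row of `B` is within `ρ + 2` of `z` (so that `B` meets the box in no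
  row or in at least two rows: `btwo_of_bnear`).
* `exists_port` — the port of the `C`-path at the first entry into the cleared columns.
* `exists_surgery_noB` (box meets no cell of `B`: standard surgery in a full box),
  `exists_surgeryB_near` (box meets `B`: trunk from the first vertex of `Γ` over the box, through
  the box minus the column `x = b`, to a vertex `β ∈ B̄` in a row other than the port's),
  `exists_gadget_seg` (with the direct gluings near `A` / near `C`: every configuration of `𝒳`
  has a `GadgetSpec` of radius `3ρ + 3`).
* `glueLinear_seg`, `glueLinear_seg_rect` — PROVED: **GL0, linear regime, segment target**:
  `P_p[A ⟷^S B] · P_p[C ⟷^S D] ≤ (1 + λ^s) · P_p[C ⟷^S A]` (`s = 3(5k+4)(12ρ+13)²`), under the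
  planar-crossing hypothesis, and hypothesis-free for `A ⊆` left side, `C`/`D` on bottom/top.

## Sources

* C. M. Newman, V. Tassion, W. Wu, *Critical percolation and the minimal spanning tree in slabs*,
  Comm. Pure Appl. Math. 70 (2017), arXiv:1512.09107: §3.2, Theorems 3.6–3.7 and the proof of
  Theorem 3.7; §3.3 (uses with `X = [0,n/2]×{0}`, `Y`, `Z_i`) [NewmanTassionWu2017].
-/

noncomputable section

namespace Literature.Probability.Percolation

open MeasureTheory LatticeModels SimpleGraph

namespace NTW17

variable {k : ℕ}

/-! ## The setting -/

/-- **GL0 with a segment target**: `S = [a,b] × [c,d]` (at least four columns and rows), target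
`B = {b} × [y₁, y₂]` with `c ≤ y₁ < y₂ ≤ d`, and planar sets `A, C ⊆ S`.
[cite: NewmanTassionWu2017, §3.2 (Theorem 3.6, the rectangle S and the sets A, B, C)] -/
structure SegSetup where
  /-- left column -/
  a : ℤ
  /-- right column (the side carrying `B`) -/
  b : ℤ
  /-- bottom row -/
  c : ℤ
  /-- top row -/
  d : ℤ
  /-- bottom end of `B` -/
  y₁ : ℤ
  /-- top end of `B` -/
  y₂ : ℤ
  /-- the set to be reached -/
  A : Set (ℤ × ℤ)
  /-- the set to be glued -/
  C : Set (ℤ × ℤ)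
  hab : a + 3 ≤ b
  hcd : c + 3 ≤ d
  hy₁ : c ≤ y₁
  hy : y₁ < y₂
  hy₂ : y₂ ≤ d
  hA : A ⊆ boxR a b c d
  hC : C ⊆ boxR a b c d

namespace SegSetup

variable (V : SegSetup)

/-- The rectangle `S`. [cite: NewmanTassionWu2017, §3.2 (Theorem 3.6, S)] -/
def S : Set (ℤ × ℤ) := boxR V.a V.b V.c V.d

/-- The target segment `B = {b} × [y₁, y₂]`. [cite: NewmanTassionWu2017, §3.2 (Theorem 3.6, B)] -/
def B : Set (ℤ × ℤ) := {z | z.1 = V.b ∧ V.y₁ ≤ z.2 ∧ z.2 ≤ V.y₂}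

/-- The gluing data `(S, S, A, B, C)`. [cite: NewmanTassionWu2017, §3.2 (Theorem 3.6)] -/
def Q : GlueData := ⟨V.S, V.S, V.A, V.B, V.C, subset_rfl, boxR_finite _ _ _ _, boxR_finite _ _ _ _⟩

/-- The box `(z + B_r) ∩ S`. [cite: NewmanTassionWu2017, §3.2 (proof of Theorem 3.7, the ball B_{r+1}(z) ∩ S)] -/
def Dbox (z : ℤ × ℤ) (r : ℕ) : Set (ℤ × ℤ) :=
  boxR (max V.a (z.1 - r)) (min V.b (z.1 + r)) (max V.c (z.2 - r)) (min V.d (z.2 + r))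

/-- The box `(z + B_r) ∩ S ∖ {x = b}`. [cite: NewmanTassionWu2017, §3.2 (proof of Theorem 3.7)] -/
def DG (z : ℤ × ℤ) (r : ℕ) : Set (ℤ × ℤ) :=
  boxR (max V.a (z.1 - r)) (min (V.b - 1) (z.1 + r)) (max V.c (z.2 - r)) (min V.d (z.2 + r))

/-- `B` meets the box of radius `r` around `z` (for `z ∈ S`).
[cite: NewmanTassionWu2017, §3.2 (proof of Theorem 3.7)] -/
def Bnear (z : ℤ × ℤ) (r : ℕ) : Prop := V.b ≤ z.1 + r ∧ V.y₁ ≤ z.2 + r ∧ z.2 - r ≤ V.y₂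

/-- `B` meets the box of radius `r` around `z` in at least two rows.
[cite: NewmanTassionWu2017, §3.2 (proof of Theorem 3.7)] -/
def Btwo (z : ℤ × ℤ) (r : ℕ) : Prop := V.b ≤ z.1 + r ∧ V.y₁ + 1 ≤ z.2 + r ∧ z.2 - r + 1 ≤ V.y₂

/-- **The radius of the cleared box**: `ρ + 2`, or `ρ + 3` if `B` meets the box of radius `ρ + 2`
in exactly one row. [cite: NewmanTassionWu2017, §3.2 (proof of Theorem 3.7, the radius r)] -/
def R (ρ : ℕ) (z : ℤ × ℤ) : ℕ :=
  open scoped Classical in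
  if V.Bnear z (ρ + 2) ∧ ¬V.Btwo z (ρ + 2) then ρ + 3 else ρ + 2

variable {V}

/-- Membership in `S`. [cite: NewmanTassionWu2017, §3.2 (Theorem 3.6, S)] -/
theorem mem_S_iff {z : ℤ × ℤ} : z ∈ V.S ↔ V.a ≤ z.1 ∧ z.1 ≤ V.b ∧ V.c ≤ z.2 ∧ z.2 ≤ V.d :=
  mem_boxR_iff z

/-- Membership in `B`. [cite: NewmanTassionWu2017, §3.2 (Theorem 3.6, B)] -/
theorem mem_B_iff {z : ℤ × ℤ} : z ∈ V.B ↔ z.1 = V.b ∧ V.y₁ ≤ z.2 ∧ z.2 ≤ V.y₂ := Iff.rfl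

/-- `B ⊆ S`. [cite: NewmanTassionWu2017, §3.2 (Theorem 3.6, B ⊆ ∂S)] -/
theorem B_subset_S : V.B ⊆ V.S := by
  intro z hz
  rw [mem_B_iff] at hz
  rw [mem_S_iff]
  have := V.hab; have := V.hy₁; have := V.hy₂
  omega

/-- Membership in `Dbox`. [cite: NewmanTassionWu2017, §3.2 (proof of Theorem 3.7)] -/
theorem mem_Dbox_iff {z w : ℤ × ℤ} {r : ℕ} : w ∈ V.Dbox z r ↔ w ∈ V.S ∧ w ∈ sqBox z r := by
  rw [Dbox, mem_boxR_iff, mem_S_iff, mem_sqBox_iff']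
  simp only [max_le_iff, le_min_iff]
  omega

/-- Membership in `DG`. [cite: NewmanTassionWu2017, §3.2 (proof of Theorem 3.7)] -/
theorem mem_DG_iff {z w : ℤ × ℤ} {r : ℕ} : w ∈ V.DG z r ↔ w ∈ V.S ∧ w ∈ sqBox z r ∧ w.1 ≠ V.b := by
  rw [DG, mem_boxR_iff, mem_S_iff, mem_sqBox_iff']
  simp only [max_le_iff, le_min_iff]
  omega

/-- `Dbox ⊆ S`. [cite: NewmanTassionWu2017, §3.2 (proof of Theorem 3.7)] -/
theorem Dbox_subset_S (z : ℤ × ℤ) (r : ℕ) : V.Dbox z r ⊆ V.S := fun _ h => (mem_Dbox_iff.1 h).1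

/-- `Dbox ⊆ z + B_r`. [cite: NewmanTassionWu2017, §3.2 (proof of Theorem 3.7)] -/
theorem Dbox_subset_sqBox (z : ℤ × ℤ) (r : ℕ) : V.Dbox z r ⊆ sqBox z r := fun _ h => (mem_Dbox_iff.1 h).2

/-- `DG ⊆ Dbox`. [cite: NewmanTassionWu2017, §3.2 (proof of Theorem 3.7)] -/
theorem DG_subset_Dbox (z : ℤ × ℤ) (r : ℕ) : V.DG z r ⊆ V.Dbox z r := fun _ h =>
  mem_Dbox_iff.2 ⟨(mem_DG_iff.1 h).1, (mem_DG_iff.1 h).2.1⟩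

/-- `DG` avoids `B`. [cite: NewmanTassionWu2017, §3.2 (proof of Theorem 3.7)] -/
theorem DG_disjoint_B {z w : ℤ × ℤ} {r : ℕ} (h : w ∈ V.DG z r) : w ∉ V.B := fun hB =>
  (mem_DG_iff.1 h).2.2 hB.1

/-- A cell of `B` in the box of radius `r` around `z ∈ S` witnesses `Bnear`.
[cite: NewmanTassionWu2017, §3.2 (proof of Theorem 3.7)] -/
theorem bnear_of_mem {z w : ℤ × ℤ} {r : ℕ} (hw : w ∈ V.B) (hwz : w ∈ sqBox z r) : V.Bnear z r := by
  rw [mem_B_iff] at hw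
  rw [mem_sqBox_iff'] at hwz
  exact ⟨by omega, by omega, by omega⟩

/-- The radius is `ρ + 2` or `ρ + 3`. [cite: NewmanTassionWu2017, §3.2 (proof of Theorem 3.7)] -/
theorem R_bounds (ρ : ℕ) (z : ℤ × ℤ) : ρ + 2 ≤ V.R ρ z ∧ V.R ρ z ≤ ρ + 3 := by
  unfold R; split_ifs <;> omega

/-- **If `B` meets the cleared box, it meets it in at least two rows.**
[cite: NewmanTassionWu2017, §3.2 (proof of Theorem 3.7)] -/
theorem btwo_of_bnear {ρ : ℕ} {z : ℤ × ℤ} (h : V.Bnear z (V.R ρ z)) : V.Btwo z (V.R ρ z) := by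
  classical
  have hy := V.hy
  unfold R at h ⊢
  by_cases hc : V.Bnear z (ρ + 2) ∧ ¬V.Btwo z (ρ + 2)
  · rw [if_pos hc] at h ⊢
    obtain ⟨⟨h1, h2, h2'⟩, h3⟩ := hc
    simp only [Btwo, Bnear, not_and, not_le] at h3 h ⊢
    push_cast at h1 h2 h2' h3 h ⊢
    omega
  · rw [if_neg hc] at h ⊢
    rw [not_and_or, not_not] at hc
    rcases hc with hc | hc
    · exact absurd h hc
    · exact hc

end SegSetup

/-! ## The port at the first entry -/

section Port

variable {Q : GlueData} {ω : BondConfig (slab 3 k)} {ρ : ℕ}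

/-- **The port of the `C`-path.** For a normalised contact `l ++ [q]` (an `ω`-open self-avoiding
path from `c₀` inside `R̄`, no vertex of `l` within `ρ` of `Γ̄`, `l ≠ []`) and a planar set `D`
containing `planar q` but not `planar c₀`: the first vertex `w'` of the path over `D`, its
predecessor `q₁ ∉ D̄` (a lattice neighbour), the `ω`-open connection from `q₁` back to `c₀` off
`D̄`, and `w'` is not within `ρ - 1` of `Γ̄`.
[cite: NewmanTassionWu2017, §3.2 (proof of Theorem 3.7, step (1), the vertex w′ and the path π)] -/
theorem exists_port (hω : ω ⊆ (slabGraph 3 k).edgeSet) {c₀ q : slab 3 k} {l : List (slab 3 k)}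
    (hch : (l ++ [q]).IsChain (fun a b => s(a, b) ∈ ω ∧ a ≠ b)) (hnd : (l ++ [q]).Nodup)
    (hsub : ∀ x ∈ l ++ [q], x ∈ slabLift k Q.R) (hhead : (l ++ [q]).head (by simp) = c₀)
    (hfar : ∀ x ∈ l, ¬Near k (Q.γ k ω) ρ (planar k x)) (hl : l ≠ []) (hρ : 1 ≤ ρ)
    {D : Set (ℤ × ℤ)} (hqD : planar k q ∈ D) (hc₀D : planar k c₀ ∉ D) :
    ∃ w' q₁ : slab 3 k, (slabGraph 3 k).Adj w' q₁ ∧ planar k w' ∈ D ∧ planar k q₁ ∉ D ∧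
      ω ∈ openConnIn (slabLift k (Q.R \ D)) q₁ c₀ ∧ ¬Near k (Q.γ k ω) (ρ - 1) (planar k w') := by
  have hqn : ¬Near k (Q.γ k ω) (ρ - 1) (planar k q) := not_near_pred_of_contact hω hch hfar hl hρ
  have hheadD : planar k ((l ++ [q]).head (by simp)) ∉ D := by rw [hhead]; exact hc₀D
  obtain ⟨m, w', rest, hm, hLeq, hmD, hw'D, hedge, -, -, hconn, -⟩ :=
    exists_entry (R := Q.R) hch hnd hsub (by simp) hheadD ⟨q, by simp, hqD⟩
  rw [hhead] at hconn
  have hadj : (slabGraph 3 k).Adj (m.getLast hm) w' := (SimpleGraph.mem_edgeSet _).1 (hω hedge)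
  refine ⟨w', m.getLast hm, hadj.symm, hw'D, hmD _ (List.getLast_mem hm), openConnIn_reverse hconn, ?_⟩
  have hw'mem : w' ∈ l ++ [q] := by rw [hLeq]; simp
  rcases List.mem_append.1 hw'mem with h | h
  · exact fun hn => hfar w' h (hn.mono (by omega))
  · rw [List.mem_singleton] at h
    rw [h]; exact hqn

/-- In a normalised contact on `evX` whose contact point is not a `C`-cell, the path is
non-trivial. [cite: NewmanTassionWu2017, §3.2 (proof of Theorem 3.7, step (1))] -/
theorem contact_ne_nil {c₀ q : slab 3 k} {l : List (slab 3 k)} (hc₀ : c₀ ∈ slabLift k Q.C)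
    (hhead : (l ++ [q]).head (by simp) = c₀) {r : ℕ} (hnC : ∀ c' ∈ Q.C, c' ∉ sqBox (planar k q) r) :
    l ≠ [] := by
  rintro rfl
  simp only [List.nil_append, List.head_cons] at hhead
  have : planar k q ∈ Q.C := by rw [hhead]; exact hc₀
  exact hnC _ this (mem_sqBox_self _ _)

/-- The `C`-path from `c₀` joins each of its vertices to `c₀` inside `R̄`; so none of them lies in
`Ā` on `evX`. [cite: NewmanTassionWu2017, §3.2 (proof of Theorem 3.7)] -/
theorem not_mem_A_of_mem_contact (hX : ω ∈ Q.evX k) {c₀ q : slab 3 k} {l : List (slab 3 k)}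
    (hc₀ : c₀ ∈ slabLift k Q.C) (hch : (l ++ [q]).IsChain (fun a b => s(a, b) ∈ ω ∧ a ≠ b))
    (hsub : ∀ x ∈ l ++ [q], x ∈ slabLift k Q.R) (hhead : (l ++ [q]).head (by simp) = c₀)
    {x : slab 3 k} (hx : x ∈ l ++ [q]) : planar k x ∉ Q.A := by
  intro hxA
  obtain ⟨l0, l', hl0⟩ := List.exists_cons_of_ne_nil (show l ++ [q] ≠ [] by simp)
  have hsub' : ∀ y ∈ l0 :: l', y ∈ slabLift k Q.R := fun y hy => hsub y (by rw [hl0]; exact hy)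
  have h1 := openConnIn_head_of_mem l0 l' (by rw [← hl0]; exact hch) hsub' x (by rw [← hl0]; exact hx)
  have hh : l0 = c₀ := by
    have := (List.head_eq_iff_head?_eq_some _).1 hhead
    rw [hl0] at this; simpa using this
  rw [hh] at h1
  exact Q.not_joined_of_evX hX (a := x) (c := c₀) hxA hc₀ (openConnIn_reverse h1)

end Port

/-! ## A predecessor on `Γ` -/

section Pred

variable {Q : GlueData} {ω : BondConfig (slab 3 k)}

/-- A vertex of `Γ` other than its first has a predecessor on `Γ`: a lattice neighbour, distinct
from it and from the last vertex of `Γ`. [cite: NewmanTassionWu2017, §3.2 (proof of Theorem 3.7, step (1))] -/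
theorem exists_pred (hω : ω ⊆ (slabGraph 3 k).edgeSet) (hA : ω ∈ Q.evAB k) {v : slab 3 k}
    (hv : v ∈ Q.γ k ω) (hvh : v ≠ (Q.γ k ω).head (Q.γ_spec hA).1.ne_nil) :
    ∃ u ∈ Q.γ k ω, (slabGraph 3 k).Adj u v ∧ u ≠ v ∧ u ≠ (Q.γ k ω).getLast (Q.γ_spec hA).1.ne_nil := by
  obtain ⟨hγO, -⟩ := Q.γ_spec hA
  have hγch := isChain_adj_of_isChain_open hω hγO.chain
  have hnd := hγO.nodup
  obtain ⟨p, s, hps⟩ := List.append_of_mem hv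
  have hp : p ≠ [] := by
    rintro rfl
    exact hvh ((List.head_eq_iff_head?_eq_some _).2 (by rw [hps]; rfl)).symm
  refine ⟨p.getLast hp, by rw [hps]; exact List.mem_append_left _ (List.getLast_mem hp), ?_, ?_, ?_⟩
  · rw [hps] at hγch
    exact List.IsChain.rel_getLast_head_of_append hγch hp (by simp)
  · rw [hps, List.nodup_append] at hnd
    exact fun h => hnd.2.2 _ (List.getLast_mem hp) v (by simp) h
  · intro h
    have hmem : (Q.γ k ω).getLast hγO.ne_nil ∈ v :: s := by
      rw [List.getLast_congr _ (by simp) hps, List.getLast_append_of_ne_nil _ (by simp)]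
      exact List.getLast_mem _
    rw [hps, List.nodup_append] at hnd
    exact hnd.2.2 _ (List.getLast_mem hp) _ hmem h

/-- On `evX` with no cell of `A` within `r ≥ ρ` of a point `z` within `ρ` of the vertex `g₀` of `Γ`,
`g₀` is not the first vertex of `Γ`. [cite: NewmanTassionWu2017, §3.2 (proof of Theorem 3.7, step (1))] -/
theorem ne_head_of_far_A (hA : ω ∈ Q.evAB k) {g₀ : slab 3 k} {z : ℤ × ℤ} {ρ r : ℕ}
    (hz : z ∈ sqBox (planar k g₀) ρ) (hρr : ρ ≤ r) (hnA : ∀ a' ∈ Q.A, a' ∉ sqBox z r) :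
    g₀ ≠ (Q.γ k ω).head (Q.γ_spec hA).1.ne_nil := by
  intro h
  have : planar k g₀ ∈ Q.A := by rw [h]; exact head_mem_A hA
  exact hnA _ this (sqBox_mono _ hρr (GlueGeom.mem_sqBox_comm hz))

end Pred

/-! ## Assembling a `SurgeryB` from the decomposition and one route -/

section AssembleB

variable {Q : GlueData} {ω : BondConfig (slab 3 k)}

/-- **A route to a target vertex from THE first cleared vertex, plus port data, is a `SurgeryB`.**
[cite: NewmanTassionWu2017, §3.2 (proof of Theorem 3.7, steps (1)–(3))] -/
theorem exists_surgeryB_of_decomp {D : Set (ℤ × ℤ)} (hDR : D ⊆ Q.R)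
    (hDA : ∀ z ∈ D, z ∉ Q.A) {p₀ rest : List (slab 3 k)} {E₁ β w' q₁ cC : slab 3 k}
    (hγ : Q.γ k ω = p₀ ++ E₁ :: rest) (hp₀ : p₀ ≠ []) (hrest : rest ≠ [])
    (hp₀D : ∀ x ∈ p₀, planar k x ∉ D) (hE₁D : planar k E₁ ∈ D) (hE₁β : E₁ ≠ β)
    (hβD : planar k β ∈ D) (hβS : planar k β ∈ Q.S) (hβB : planar k β ∈ Q.B)
    (hadj : (slabGraph 3 k).Adj w' q₁) (hq₁D : planar k q₁ ∉ D)
    (hcC : cC ∈ slabLift k Q.C) (hσ : ω ∈ openConnIn (slabLift k (Q.R \ D)) q₁ cC)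
    {L Br : List (slab 3 k)} {c : slab 3 k} (spec : RouteSpec k D D E₁ β w' L Br c)
    (hint : ∀ v ∈ L, v ≠ E₁ → v ≠ β → planar k v ∈ Q.S ∧ planar k v ∉ Q.B) :
    ∃ sb : Q.SurgeryB k ω, sb.D = D := by
  set P := L.tail.dropLast with hP
  have hLeq : L = E₁ :: (P ++ [β]) := spec.hL.eq_cons_dropLast_concat hE₁β
  have hPL : ∀ v ∈ P, v ∈ L := fun v hv => by
    rw [hLeq]; exact List.mem_cons_of_mem _ (List.mem_append_left _ hv)
  have hPne : ∀ v ∈ P, v ≠ E₁ ∧ v ≠ β := by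
    intro v hv
    have hnd := spec.hL.nodup
    rw [hLeq] at hnd
    refine ⟨fun h => ?_, fun h => ?_⟩
    · exact (List.nodup_cons.1 hnd).1 (List.mem_append_left _ (h ▸ hv))
    · have := (List.nodup_cons.1 hnd).2
      rw [List.nodup_append] at this
      exact this.2.2 v hv β (by simp) h
  have hq₁CB : q₁ ∉ c :: Br := by
    intro h
    rcases List.mem_cons.1 h with rfl | h
    · exact hq₁D (spec.hL_sub _ spec.hc)
    · exact hq₁D (spec.hBr_sub _ h)
  have hCBq : SPath ((c :: Br) ++ [q₁]) c q₁ := spec.hCB.concat hadj hq₁CB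
  have hc : c ∈ E₁ :: P := by
    have := spec.hc
    rw [hLeq] at this
    rcases List.mem_cons.1 this with h | h
    · exact List.mem_cons.2 (Or.inl h)
    · rcases List.mem_append.1 h with h | h
      · exact List.mem_cons_of_mem _ h
      · rw [List.mem_singleton] at h
        exact absurd h spec.hcE₂
  refine ⟨⟨D, p₀, E₁, rest, P, β, c, Br, q₁, cC, hDR, hDA, hγ, hp₀, hrest, hp₀D, hE₁D,
    fun x hx => spec.hL_sub x (hPL x hx),
    fun x hx => (hint x (hPL x hx) (hPne x hx).1 (hPne x hx).2).1,
    fun x hx => (hint x (hPL x hx) (hPne x hx).1 (hPne x hx).2).2,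
    hβD, hβS, hβB,
    hLeq ▸ spec.hL.chain, hLeq ▸ spec.hL.nodup, hc, spec.hBr_sub, hq₁D,
    by simpa using hCBq.chain, by simpa using hCBq.nodup,
    fun x hx => hLeq ▸ spec.hBr_L x hx, fun l₁ l₂ y h => ?_, hcC, hσ⟩, rfl⟩
  have hh : (Br ++ [q₁]).head (by simp) = Br.head spec.hBr := by
    simp [List.head_append_of_ne_nil spec.hBr]
  rw [hh]
  exact spec.hfwd l₁ l₂ y (hLeq.trans h) _ (List.head?_eq_some_head spec.hBr ▸ rfl)

end AssembleB

/-- Planar adjacency of a cell and its left neighbour. [cite: NewmanTassionWu2017, §2.3 (Notation)] -/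
theorem planarAdj_left {z w : ℤ × ℤ} (h1 : w.1 = z.1 - 1) (h2 : w.2 = z.2) : planarAdj w z := by
  obtain ⟨z1, z2⟩ := z; obtain ⟨w1, w2⟩ := w
  simp only at h1 h2
  subst h1; subst h2
  simp [planarAdj]

/-- Adjacency of two slab vertices at the same height over planar-adjacent cells.
[cite: NewmanTassionWu2017, §2.3 (Notation)] -/
theorem adj_of_planarAdj {u v : slab 3 k} (hh : ht u = ht v) (hp : planarAdj (planar k u) (planar k v)) :
    (slabGraph 3 k).Adj u v :=
  (slab_adj_iff u v).2 (Or.inl ⟨hh, hp⟩)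

/-! ## The local modifications for a segment target -/

section Constructions

variable {V : SegSetup} {ω : BondConfig (slab 3 k)} {ρ : ℕ}

/-- **Contact far from `A`, `C` and `B`**: the cleared box `(z + B_R) ∩ S` meets no cell of `B`; a
standard surgery (reroute `Γ` through the full box, port to the `C`-cluster).
[cite: NewmanTassionWu2017, §3.2 (proof of Theorem 3.7, steps (1)–(3))] -/
theorem exists_surgery_noB (hk : 1 ≤ k) (hρ : 2 ≤ ρ) (hω : ω ⊆ (slabGraph 3 k).edgeSet)
    (hX : ω ∈ V.Q.evX k) {c₀ q : slab 3 k} {l : List (slab 3 k)} (hc₀ : c₀ ∈ slabLift k V.C)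
    (hch : (l ++ [q]).IsChain (fun a b => s(a, b) ∈ ω ∧ a ≠ b)) (hnd : (l ++ [q]).Nodup)
    (hsub : ∀ x ∈ l ++ [q], x ∈ slabLift k V.S) (hhead : (l ++ [q]).head (by simp) = c₀)
    (hnear : Near k (V.Q.γ k ω) ρ (planar k q)) (hfar : ∀ x ∈ l, ¬Near k (V.Q.γ k ω) ρ (planar k x))
    (hnA : ∀ a' ∈ V.A, a' ∉ sqBox (planar k q) (ρ + 3))
    (hnC : ∀ c' ∈ V.C, c' ∉ sqBox (planar k q) (ρ + 3))
    (hnB : ¬V.Bnear (planar k q) (V.R ρ (planar k q))) :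
    ∃ sx : V.Q.Surgery k ω, sx.D ⊆ sqBox (planar k q) (ρ + 3) := by
  have hA : ω ∈ V.Q.evAB k := hX.1
  obtain ⟨hγO, -⟩ := V.Q.γ_spec hA
  set z := planar k q with hzdef
  obtain ⟨hR1, hR2⟩ := SegSetup.R_bounds (V := V) ρ z
  set R := V.R ρ z with hRdef
  set D := V.Dbox z R with hDdef
  have hzS : z ∈ V.S := hsub q (by simp)
  have hDz : D ⊆ sqBox z (ρ + 3) := (SegSetup.Dbox_subset_sqBox _ _).trans (sqBox_mono _ hR2)
  have hl : l ≠ [] := contact_ne_nil (Q := V.Q) hc₀ hhead hnC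
  have hzD : z ∈ D := SegSetup.mem_Dbox_iff.2 ⟨hzS, mem_sqBox_self _ _⟩
  have hc₀D : planar k c₀ ∉ D := fun h => hnC _ hc₀ (hDz h)
  have hDA : ∀ w ∈ D, w ∉ V.Q.A := fun w hw hwA => hnA w hwA (hDz hw)
  have hDB : ∀ w ∈ D, w ∉ V.Q.B := fun w hw hwB =>
    hnB (SegSetup.bnear_of_mem hwB (SegSetup.Dbox_subset_sqBox _ _ hw))
  -- the port
  obtain ⟨w', q₁, hadj, hw'D, hq₁D, hσ, hw'far⟩ :=
    exists_port (Q := V.Q) hω hch hnd hsub hhead hfar hl (by omega) hzD hc₀D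
  -- two vertices of `γ` over `D`: `g₀` and its predecessor
  obtain ⟨g₀, hg₀, hz⟩ := hnear
  have hg₀z : planar k g₀ ∈ sqBox z ρ := GlueGeom.mem_sqBox_comm hz
  have hg₀h := ne_head_of_far_A (Q := V.Q) hA hz (by omega : ρ ≤ ρ + 3) hnA
  obtain ⟨u, huγ, hadj₀, hune, -⟩ := exists_pred hω hA hg₀ hg₀h
  have hg₀D : planar k g₀ ∈ D :=
    SegSetup.mem_Dbox_iff.2 ⟨hγO.subset g₀ hg₀, sqBox_mono _ (by omega) hg₀z⟩
  have huD : planar k u ∈ D := by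
    refine SegSetup.mem_Dbox_iff.2 ⟨hγO.subset u huγ, sqBox_mono _ (by omega : ρ + 1 ≤ R) ?_⟩
    exact mem_sqBox_add hg₀z (planar_mem_sqBox_one_of_adj hadj₀.symm)
  have htwo : ∃ x ∈ V.Q.γ k ω, ∃ y ∈ V.Q.γ k ω, x ≠ y ∧ planar k x ∈ D ∧ planar k y ∈ D :=
    ⟨u, huγ, g₀, hg₀, hune, huD, hg₀D⟩
  -- routing in the full box `D`
  have hroute : ∀ E₁ E₂ : slab 3 k, E₁ ∈ V.Q.γ k ω → E₂ ∈ V.Q.γ k ω → E₁ ≠ E₂ →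
      planar k E₁ ∈ D → planar k E₂ ∈ D → ∃ L Br c, RouteSpec k D D E₁ E₂ w' L Br c := by
    intro E₁ E₂ hE₁ hE₂ hne hE₁D hE₂D
    have hzS' := hzS
    rw [SegSetup.mem_S_iff] at hzS'
    have hab := V.hab; have hcd := V.hcd
    have h1 : ¬Near k (V.Q.γ k ω) 0 (planar k w') := fun hn => hw'far (hn.mono (by omega))
    exact exists_route (xL := max V.a (z.1 - (R : ℕ))) (xR' := min V.b (z.1 + (R : ℕ)))
      (xR := min V.b (z.1 + (R : ℕ))) (rB := max V.c (z.2 - (R : ℕ)))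
      (rP := min V.d (z.2 + (R : ℕ))) (rT := min V.d (z.2 + (R : ℕ)))
      hk (by omega) le_rfl (by omega) le_rfl hE₁D hE₂D hw'D hne
      (ne_planar_of_not_near h1 hE₁).symm (ne_planar_of_not_near h1 hE₂).symm
  obtain ⟨sx, hsx⟩ := exists_surgery_of_route (Q := V.Q) hX (D := D) (Dt := D)
    (SegSetup.Dbox_subset_S _ _) hDA hDB subset_rfl (SegSetup.Dbox_subset_S _ _) htwo hadj hq₁D hc₀
    hσ hroute
  exact ⟨sx, hsx ▸ hDz⟩

/-- **Contact near the segment `B`**: the cleared box `(z + B_R) ∩ S` meets `B` (in at least two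
rows, by the choice of `R`); a surgery ending in `B̄`: trunk from the first vertex of `Γ` over the
box, through the box minus the column `x = b` (the tree's `exists_route` plus one-step adapters),
to a vertex `β ∈ B̄` in a row other than the port's and at a height other than the first
vertex's. [cite: NewmanTassionWu2017, §3.2 (proof of Theorem 3.7, steps (1)–(3), "v = v′ = z")] -/
theorem exists_surgeryB_near (hk : 1 ≤ k) (hρ : 4 ≤ ρ) (hω : ω ⊆ (slabGraph 3 k).edgeSet)
    (hX : ω ∈ V.Q.evX k) {c₀ q : slab 3 k} {l : List (slab 3 k)} (hc₀ : c₀ ∈ slabLift k V.C)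
    (hch : (l ++ [q]).IsChain (fun a b => s(a, b) ∈ ω ∧ a ≠ b)) (hnd : (l ++ [q]).Nodup)
    (hsub : ∀ x ∈ l ++ [q], x ∈ slabLift k V.S) (hhead : (l ++ [q]).head (by simp) = c₀)
    (hnear : Near k (V.Q.γ k ω) ρ (planar k q)) (hfar : ∀ x ∈ l, ¬Near k (V.Q.γ k ω) ρ (planar k x))
    (hnA : ∀ a' ∈ V.A, a' ∉ sqBox (planar k q) (ρ + 3))
    (hnC : ∀ c' ∈ V.C, c' ∉ sqBox (planar k q) (ρ + 3))
    (hB : V.Bnear (planar k q) (V.R ρ (planar k q))) :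
    ∃ sb : V.Q.SurgeryB k ω, sb.D ⊆ sqBox (planar k q) (ρ + 3) := by
  have hA : ω ∈ V.Q.evAB k := hX.1
  obtain ⟨hγO, -⟩ := V.Q.γ_spec hA
  set z := planar k q with hzdef
  obtain ⟨hR1, hR2⟩ := SegSetup.R_bounds (V := V) ρ z
  have hB2 := SegSetup.btwo_of_bnear hB
  set R := V.R ρ z with hRdef
  set D := V.Dbox z R with hDdef
  set RP := V.DG z R with hRPdef
  have hzS : z ∈ V.S := hsub q (by simp)
  have hzS' := hzS
  rw [SegSetup.mem_S_iff] at hzS'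
  have hab := V.hab; have hcd := V.hcd; have hy₁ := V.hy₁; have hy₂ := V.hy₂; have hy := V.hy
  obtain ⟨hBx, hBy, hBy'⟩ := hB2
  have hDz : D ⊆ sqBox z (ρ + 3) := (SegSetup.Dbox_subset_sqBox _ _).trans (sqBox_mono _ hR2)
  have hRPD : RP ⊆ D := SegSetup.DG_subset_Dbox _ _
  have hl : l ≠ [] := contact_ne_nil (Q := V.Q) hc₀ hhead hnC
  have hzD : z ∈ D := SegSetup.mem_Dbox_iff.2 ⟨hzS, mem_sqBox_self _ _⟩
  have hc₀D : planar k c₀ ∉ D := fun h => hnC _ hc₀ (hDz h)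
  have hDA : ∀ w ∈ D, w ∉ V.Q.A := fun w hw hwA => hnA w hwA (hDz hw)
  -- membership criteria
  have memRP : ∀ w : ℤ × ℤ, V.a ≤ w.1 → w.1 ≤ V.b - 1 → z.1 - R ≤ w.1 → w.1 ≤ z.1 + R →
      V.c ≤ w.2 → w.2 ≤ V.d → z.2 - R ≤ w.2 → w.2 ≤ z.2 + R → w ∈ RP := by
    intro w h1 h2 h3 h4 h5 h6 h7 h8
    rw [SegSetup.mem_DG_iff, SegSetup.mem_S_iff, mem_sqBox_iff']
    exact ⟨⟨h1, by omega, h5, h6⟩, ⟨h3, h4, h7, h8⟩, by omega⟩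
  have memD : ∀ w : ℤ × ℤ, w ∈ D → V.a ≤ w.1 ∧ w.1 ≤ V.b ∧ z.1 - R ≤ w.1 ∧ w.1 ≤ z.1 + R ∧
      V.c ≤ w.2 ∧ w.2 ≤ V.d ∧ z.2 - R ≤ w.2 ∧ w.2 ≤ z.2 + R := by
    intro w hw
    rw [SegSetup.mem_Dbox_iff, SegSetup.mem_S_iff, mem_sqBox_iff'] at hw
    omega
  -- the port
  obtain ⟨w', q₁, hadj, hw'D, hq₁D, hσ, hw'far⟩ :=
    exists_port (Q := V.Q) hω hch hnd hsub hhead hfar hl (by omega) hzD hc₀D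
  -- a vertex of `γ` over `D` other than the last
  obtain ⟨g₀, hg₀, hz⟩ := hnear
  have hg₀z : planar k g₀ ∈ sqBox z ρ := GlueGeom.mem_sqBox_comm hz
  have hg₀h := ne_head_of_far_A (Q := V.Q) hA hz (by omega : ρ ≤ ρ + 3) hnA
  have hin : ∃ x ∈ V.Q.γ k ω, planar k x ∈ D ∧ x ≠ (V.Q.γ k ω).getLast hγO.ne_nil := by
    by_cases hlast : g₀ = (V.Q.γ k ω).getLast hγO.ne_nil
    · obtain ⟨u, huγ, hadj₀, -, hul⟩ := exists_pred hω hA hg₀ hg₀h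
      refine ⟨u, huγ, SegSetup.mem_Dbox_iff.2 ⟨hγO.subset u huγ, sqBox_mono _ (by omega : ρ + 1 ≤ R) ?_⟩, hul⟩
      exact mem_sqBox_add hg₀z (planar_mem_sqBox_one_of_adj hadj₀.symm)
    · exact ⟨g₀, hg₀, SegSetup.mem_Dbox_iff.2 ⟨hγO.subset g₀ hg₀, sqBox_mono _ (by omega) hg₀z⟩, hlast⟩
  -- the decomposition at the first vertex over `D`
  obtain ⟨p₀, E₁, rest, hγeq, hp₀, hrest, hp₀D, hE₁D⟩ := exists_decompB (Q := V.Q) hA hDA hin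
  have hE₁γ : E₁ ∈ V.Q.γ k ω := by rw [hγeq]; simp
  have hE₁B : planar k E₁ ∉ V.B := by
    intro hB'
    have hex : ∃ l, IsOSAP k ω (slabLift k V.Q.S) (slabLift k V.Q.A) (slabLift k V.Q.B) l :=
      (mem_slabConn_iff_exists_isOSAP ω _ _ _).1 hA
    have h := minPath_prefix_getLast_not_mem V.Q.S_finite hex (p := p₀ ++ [E₁]) (s := rest)
      (by rw [show minPath k ω _ _ _ = V.Q.γ k ω from rfl, hγeq]; simp) hrest (by simp)
    simp at h
    exact h hB'
  obtain ⟨ha1, ha2, ha3, ha4, ha5, ha6, ha7, ha8⟩ := memD _ hE₁D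
  obtain ⟨hw1, hw2, hw3, hw4, hw5, hw6, hw7, hw8⟩ := memD _ hw'D
  -- the target vertex `β`
  set yw : ℤ := (planar k w').2 with hywdef
  set yU : ℤ := min V.y₂ (z.2 + R) with hyUdef
  set yL : ℤ := max V.y₁ (z.2 - R) with hyLdef
  set yβ : ℤ := if yw = yU then yL else yU with hyβdef
  have hyβ : V.y₁ ≤ yβ ∧ yβ ≤ V.y₂ ∧ z.2 - R ≤ yβ ∧ yβ ≤ z.2 + R ∧ yβ ≠ yw := by
    rw [hyβdef]; split_ifs with h <;> omega
  obtain ⟨hyβ1, hyβ2, hyβ3, hyβ4, hyβw⟩ := hyβ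
  set hβ : ℕ := if ht E₁ = 0 then 1 else 0 with hhβdef
  have hhβk : hβ ≤ k := by rw [hhβdef]; split_ifs <;> omega
  have hhβne : hβ ≠ ht E₁ := by rw [hhβdef]; split_ifs with h <;> omega
  set β : slab 3 k := vtx k (V.b, yβ) hβ with hβdef
  set β' : slab 3 k := vtx k (V.b - 1, yβ) hβ with hβ'def
  have hβp : planar k β = (V.b, yβ) := planar_vtx _ _
  have hβ'p : planar k β' = (V.b - 1, yβ) := planar_vtx _ _
  have hβB : planar k β ∈ V.B := by rw [hβp, SegSetup.mem_B_iff]; exact ⟨rfl, hyβ1, hyβ2⟩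
  have hβS : planar k β ∈ V.S := SegSetup.B_subset_S hβB
  have hβD : planar k β ∈ D := by
    rw [hβp, SegSetup.mem_Dbox_iff, SegSetup.mem_S_iff, mem_sqBox_iff']
    refine ⟨⟨?_, ?_, ?_, ?_⟩, ?_, ?_, ?_, ?_⟩ <;> dsimp only <;> omega
  have hβ'RP : planar k β' ∈ RP := by
    rw [hβ'p]; refine memRP _ ?_ ?_ ?_ ?_ ?_ ?_ ?_ ?_ <;> dsimp only <;> omega
  have hadjβ : (slabGraph 3 k).Adj β' β := by
    refine adj_of_planarAdj (by rw [hβdef, hβ'def, ht_vtx hhβk, ht_vtx hhβk]) ?_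
    rw [hβp, hβ'p]
    exact planarAdj_left (by simp) (by simp)
  -- the terminal `E₁'` of the route (one step inward if `E₁` lies over the column `x = b`)
  set e₁ := planar k E₁ with he₁def
  set E₁' : slab 3 k := if e₁.1 = V.b then vtx k (V.b - 1, e₁.2) (ht E₁) else E₁ with hE₁'def
  have hE₁'ht : ht E₁' = ht E₁ := by
    rw [hE₁'def]; split_ifs
    · exact ht_vtx (ht_le E₁) _
    · rfl
  have hE₁'p : planar k E₁' ∈ sqBox e₁ 1 ∧ planar k E₁' ∈ RP := by
    rw [hE₁'def]; split_ifs with h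
    · rw [planar_vtx]
      refine ⟨by rw [mem_sqBox_iff']; dsimp only; omega, ?_⟩
      refine memRP _ ?_ ?_ ?_ ?_ ?_ ?_ ?_ ?_ <;> dsimp only <;> omega
    · refine ⟨mem_sqBox_self _ _, ?_⟩
      rw [SegSetup.mem_DG_iff]
      exact ⟨hγO.subset E₁ hE₁γ, (SegSetup.mem_Dbox_iff.1 hE₁D).2, h⟩
  obtain ⟨hE₁'near, hE₁'RP⟩ := hE₁'p
  have hE₁'β' : E₁' ≠ β' := by
    intro h
    have := congrArg ht h
    rw [hE₁'ht, hβ'def, ht_vtx hhβk] at this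
    exact hhβne this.symm
  -- the terminal `w''` of the route (one step inward if `w'` lies over the column `x = b`)
  set ew := planar k w' with hewdef
  set w'' : slab 3 k := if ew.1 = V.b then vtx k (V.b - 1, ew.2) (ht w') else w' with hw''def
  have hw''p : planar k w'' ∈ sqBox ew 1 ∧ planar k w'' ∈ RP ∧ (planar k w'').2 = yw := by
    rw [hw''def]; split_ifs with h
    · rw [planar_vtx]
      refine ⟨by rw [mem_sqBox_iff']; dsimp only; omega, ?_, by simp [hywdef, hewdef]⟩
      refine memRP _ ?_ ?_ ?_ ?_ ?_ ?_ ?_ ?_ <;> dsimp only <;> omega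
    · refine ⟨mem_sqBox_self _ _, ?_, rfl⟩
      rw [SegSetup.mem_DG_iff]
      exact ⟨(SegSetup.mem_Dbox_iff.1 hw'D).1, (SegSetup.mem_Dbox_iff.1 hw'D).2, h⟩
  obtain ⟨hw''near, hw''RP, hw''y⟩ := hw''p
  have hw''E₁' : planar k E₁' ≠ planar k w'' := by
    intro h
    -- then `planar w'` is within `2` of `e₁ ∈ γ̄`, contradicting `¬ Near (ρ - 1)`
    apply hw'far
    refine Near.mono (by omega : 2 ≤ ρ - 1) ⟨E₁, hE₁γ, ?_⟩
    have h1 : planar k w'' ∈ sqBox e₁ 1 := h ▸ hE₁'near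
    have h2 : ew ∈ sqBox (planar k w'') 1 := GlueGeom.mem_sqBox_comm hw''near
    exact mem_sqBox_add h1 h2
  have hw''β' : planar k β' ≠ planar k w'' := by
    intro h
    have := congrArg Prod.snd h
    rw [hβ'p, hw''y] at this
    exact hyβw (by simpa using this)
  -- the route in `RP`
  obtain ⟨L, Br, c, spec⟩ := exists_route (xL := max V.a (z.1 - (R : ℕ)))
    (xR' := min (V.b - 1) (z.1 + (R : ℕ))) (xR := min (V.b - 1) (z.1 + (R : ℕ)))
    (rB := max V.c (z.2 - (R : ℕ))) (rP := min V.d (z.2 + (R : ℕ))) (rT := min V.d (z.2 + (R : ℕ)))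
    hk (by omega) le_rfl (by omega) le_rfl hE₁'RP hβ'RP hw''RP hE₁'β'
    hw''E₁' hw''β'
  have hLRP : ∀ v ∈ L, planar k v ∈ RP := spec.hL_sub
  have hBrRP : ∀ v ∈ Br, planar k v ∈ RP := spec.hBr_sub
  have notRP_b : ∀ w : ℤ × ℤ, w.1 = V.b → w ∉ RP := fun w hw h => (SegSetup.mem_DG_iff.1 h).2.2 hw
  have hw'E₁ : w' ≠ E₁ := by
    intro h
    exact hw'far (Near.mono (Nat.zero_le _) ⟨E₁, hE₁γ, by rw [hewdef, h]; exact mem_sqBox_self _ 0⟩)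
  -- step 1: the branch ends at `w'`
  obtain ⟨Br₁, spec₁, hBr₁⟩ : ∃ Br₁, RouteSpec k RP D E₁' β' w' L Br₁ c ∧
      ∀ v ∈ Br₁, planar k v ∈ RP ∨ v = w' := by
    by_cases h : ew.1 = V.b
    · have hw''eq : w'' = vtx k (V.b - 1, ew.2) (ht w') := by rw [hw''def, if_pos h]
      have hadjw : (slabGraph 3 k).Adj w'' w' := by
        refine adj_of_planarAdj (by rw [hw''eq, ht_vtx (ht_le _)]) ?_
        rw [hw''eq, planar_vtx]
        exact planarAdj_left (by dsimp only; rw [← hewdef]; omega) rfl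
      have hw'L : w' ∉ L := fun hm => notRP_b ew h (hLRP _ hm)
      have hw'CB : w' ∉ c :: Br := by
        intro hm
        rcases List.mem_cons.1 hm with hm | hm
        · exact notRP_b ew h (by rw [hewdef, hm]; exact hLRP _ spec.hc)
        · exact notRP_b ew h (hBrRP _ hm)
      refine ⟨Br ++ [w'], RouteSpec.concat_branch spec hRPD hadjw hw'L hw'CB hw'D, fun v hv => ?_⟩
      rcases List.mem_append.1 hv with hv | hv
      · exact Or.inl (hBrRP v hv)
      · exact Or.inr (List.mem_singleton.1 hv)
    · have hw''eq : w'' = w' := by rw [hw''def, if_neg h]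
      refine ⟨Br, ?_, fun v hv => Or.inl (hBrRP v hv)⟩
      rw [← hw''eq]; exact RouteSpec.mono spec subset_rfl hRPD
  -- step 2: the trunk starts at `E₁`
  obtain ⟨L₂, spec₂, hL₂⟩ : ∃ L₂, RouteSpec k D D E₁ β' w' L₂ Br₁ c ∧
      ∀ v ∈ L₂, v ≠ E₁ → planar k v ∈ RP := by
    by_cases h : e₁.1 = V.b
    · have hE₁'eq : E₁' = vtx k (V.b - 1, e₁.2) (ht E₁) := by rw [hE₁'def, if_pos h]
      have hadjE : (slabGraph 3 k).Adj E₁ E₁' := by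
        refine (adj_of_planarAdj (by rw [hE₁'eq, ht_vtx (ht_le _)]) ?_).symm
        rw [hE₁'eq, planar_vtx]
        exact planarAdj_left (by dsimp only; rw [← he₁def]; omega) rfl
      have hE₁L : E₁ ∉ L := fun hm => notRP_b e₁ h (hLRP _ hm)
      have hE₁Br : E₁ ∉ Br₁ := by
        intro hm
        rcases hBr₁ _ hm with h' | h'
        · exact notRP_b e₁ h h'
        · exact hw'E₁ h'.symm
      refine ⟨E₁ :: L, RouteSpec.cons_trunk spec₁ hRPD hadjE hE₁L hE₁Br hE₁D, fun v hv hne => ?_⟩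
      rcases List.mem_cons.1 hv with hv | hv
      · exact absurd hv hne
      · exact hLRP v hv
    · have hE₁'eq : E₁' = E₁ := by rw [hE₁'def, if_neg h]
      refine ⟨L, ?_, fun v hv _ => hLRP v hv⟩
      rw [← hE₁'eq]; exact RouteSpec.mono spec₁ hRPD subset_rfl
  -- step 3: the trunk ends at `β`
  have hβL₂ : β ∉ L₂ := by
    intro hm
    by_cases hβE : β = E₁
    · exact hE₁B (by rw [he₁def, ← hβE]; exact hβB)
    · exact notRP_b _ (by rw [hβp]) (hL₂ β hm hβE)
  have hβBr₁ : β ∉ Br₁ := by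
    intro hm
    rcases hBr₁ _ hm with h' | h'
    · exact notRP_b _ (by rw [hβp]) h'
    · apply hyβw
      have := congrArg (fun v => (planar k v).2) h'
      simp only [hβp] at this
      rw [this]
  have spec₃ : RouteSpec k D D E₁ β w' (L₂ ++ [β]) Br₁ c :=
    RouteSpec.concat_trunk spec₂ subset_rfl hadjβ hβL₂ hβBr₁ hβD
  have hint : ∀ v ∈ L₂ ++ [β], v ≠ E₁ → v ≠ β → planar k v ∈ V.Q.S ∧ planar k v ∉ V.Q.B := by
    intro v hv hvE hvβ
    rcases List.mem_append.1 hv with hv | hv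
    · have hvRP := hL₂ v hv hvE
      exact ⟨(SegSetup.mem_DG_iff.1 hvRP).1, SegSetup.DG_disjoint_B hvRP⟩
    · exact absurd (List.mem_singleton.1 hv) hvβ
  have hE₁β : E₁ ≠ β := fun h => hE₁B (by rw [he₁def, h]; exact hβB)
  obtain ⟨sb, hsb⟩ := exists_surgeryB_of_decomp (Q := V.Q) (SegSetup.Dbox_subset_S _ _) hDA hγeq hp₀
    hrest hp₀D hE₁D hE₁β hβD hβS hβB hadj hq₁D hc₀ hσ spec₃ hint
  exact ⟨sb, hsb ▸ hDz⟩

/-- **Direct gluing near `A`** (segment setting): if a cell of `A` is within `ρ + 3` of the contact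
point, the `C`-cluster is glued to `Ā` inside `planar q + B_{ρ+3}`.
[cite: NewmanTassionWu2017, §3.2 (proof of Theorem 3.7, steps (2)–(3), near A)] -/
theorem exists_directGlue_A_seg (hω : ω ⊆ (slabGraph 3 k).edgeSet) (hX : ω ∈ V.Q.evX k)
    (hsep : ∀ a' ∈ V.A, ∀ c' ∈ V.C, c' ∉ sqBox a' (4 * ρ + 8))
    {c₀ q : slab 3 k} {l : List (slab 3 k)} (hc₀ : c₀ ∈ slabLift k V.C)
    (hch : (l ++ [q]).IsChain (fun a b => s(a, b) ∈ ω ∧ a ≠ b)) (hnd : (l ++ [q]).Nodup)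
    (hsub : ∀ x ∈ l ++ [q], x ∈ slabLift k V.S) (hhead : (l ++ [q]).head (by simp) = c₀)
    (hA' : ∃ a' ∈ V.A, a' ∈ sqBox (planar k q) (ρ + 3)) :
    ∃ dg : DirectGlue k V.S V.C V.A ω, dg.D ⊆ sqBox (planar k q) (ρ + 3) := by
  set z := planar k q with hzdef
  set D := V.Dbox z (ρ + 3) with hDdef
  obtain ⟨a', ha', ha'z⟩ := hA'
  have hzS : z ∈ V.S := hsub q (by simp)
  have hDC : ∀ w ∈ D, w ∉ V.C := by
    intro w hw hwC
    have hwz := SegSetup.Dbox_subset_sqBox _ _ hw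
    have : w ∈ sqBox a' ((ρ + 3) + (ρ + 3)) := mem_sqBox_add (GlueGeom.mem_sqBox_comm ha'z) hwz
    exact hsep a' ha' w hwC (sqBox_mono _ (by omega) this)
  have hc₀D : planar k c₀ ∉ D := fun h => hDC _ h hc₀
  have hheadD : planar k ((l ++ [q]).head (by simp)) ∉ D := by rw [hhead]; exact hc₀D
  have hqD : planar k q ∈ D := SegSetup.mem_Dbox_iff.2 ⟨hzS, mem_sqBox_self _ _⟩
  obtain ⟨m, w', rest, hm, hLeq, hmD, hw'D, hedge, -, -, hconn, -⟩ :=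
    exists_entry (R := V.S) hch hnd hsub (by simp) hheadD ⟨q, by simp, hqD⟩
  rw [hhead] at hconn
  have hadj : (slabGraph 3 k).Adj (m.getLast hm) w' := (SimpleGraph.mem_edgeSet _).1 (hω hedge)
  have hw'A : planar k w' ∉ V.A :=
    not_mem_A_of_mem_contact (Q := V.Q) hX hc₀ hch hsub hhead (by rw [hLeq]; simp)
  have ha'D : a' ∈ D := SegSetup.mem_Dbox_iff.2 ⟨V.hA ha', ha'z⟩
  obtain ⟨dg, hdg⟩ := exists_directGlue (R := V.S) (Src := V.C) (Tg := V.A)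
    (SegSetup.Dbox_subset_S _ _) hDC hc₀ (hmD _ (List.getLast_mem hm)) hconn hadj hw'D hw'A ha'D ha'
  exact ⟨dg, hdg ▸ SegSetup.Dbox_subset_sqBox _ _⟩

/-- **Direct gluing near `C`** (segment setting): if a cell of `C` is within `ρ + 3` of the
contact point, the `A`-cluster is glued along `Γ` to `C̄` inside `planar q + B_{3ρ+3}`.
[cite: NewmanTassionWu2017, §3.2 (proof of Theorem 3.7, steps (2)–(3), near C)] -/
theorem exists_directGlue_C_seg (hω : ω ⊆ (slabGraph 3 k).edgeSet) (hX : ω ∈ V.Q.evX k)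
    (hsep : ∀ a' ∈ V.A, ∀ c' ∈ V.C, c' ∉ sqBox a' (4 * ρ + 8)) {q : slab 3 k}
    (hnear : Near k (V.Q.γ k ω) ρ (planar k q)) (hC' : ∃ c' ∈ V.C, c' ∈ sqBox (planar k q) (ρ + 3)) :
    ∃ dg : DirectGlue k V.S V.A V.C ω, dg.D ⊆ sqBox (planar k q) (3 * ρ + 3) := by
  have hA : ω ∈ V.Q.evAB k := hX.1
  obtain ⟨hγO, -⟩ := V.Q.γ_spec hA
  obtain ⟨g₀, hg₀, hz⟩ := hnear
  obtain ⟨c', hc', hc'z⟩ := hC'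
  set g := planar k g₀ with hgdef
  set D := V.Dbox g (2 * ρ + 3) with hDdef
  have hg₀S : g ∈ V.S := hγO.subset g₀ hg₀
  have hc'D : c' ∈ D := by
    refine SegSetup.mem_Dbox_iff.2 ⟨V.hC hc', ?_⟩
    have := mem_sqBox_add hz hc'z
    simpa [two_mul, add_assoc, add_comm, add_left_comm] using this
  have hDA : ∀ w ∈ D, w ∉ V.A := by
    intro w hw hwA
    have hwg := SegSetup.Dbox_subset_sqBox _ _ hw
    have h1 : c' ∈ sqBox g (2 * ρ + 3) := (SegSetup.mem_Dbox_iff.1 hc'D).2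
    have h2 : c' ∈ sqBox w ((2 * ρ + 3) + (2 * ρ + 3)) := mem_sqBox_add (GlueGeom.mem_sqBox_comm hwg) h1
    exact hsep w hwA c' hc' (sqBox_mono _ (by omega) h2)
  have hheadD : planar k ((V.Q.γ k ω).head hγO.ne_nil) ∉ D := fun h => hDA _ h (head_mem_A hA)
  have hg₀D : planar k g₀ ∈ D := SegSetup.mem_Dbox_iff.2 ⟨hg₀S, mem_sqBox_self _ _⟩
  obtain ⟨m, w', rest, hm, hγeq, hmD, hw'D, hedge, -, -, hconn, -⟩ :=
    exists_entry (R := V.S) hγO.chain hγO.nodup hγO.subset hγO.ne_nil hheadD ⟨g₀, hg₀, hg₀D⟩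
  have hadj : (slabGraph 3 k).Adj (m.getLast hm) w' := (SimpleGraph.mem_edgeSet _).1 (hω hedge)
  have hw'γ : w' ∈ V.Q.γ k ω := by rw [hγeq]; simp
  have hw'C : planar k w' ∉ V.C := fun h => not_mem_C_of_mem_γ hX hw'γ h
  obtain ⟨dg, hdg⟩ := exists_directGlue (R := V.S) (Src := V.A) (Tg := V.C)
    (SegSetup.Dbox_subset_S _ _) hDA (head_mem_A hA) (hmD _ (List.getLast_mem hm)) hconn hadj
    hw'D hw'C hc'D hc'
  refine ⟨dg, hdg ▸ fun w hw => ?_⟩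
  have h1 := SegSetup.Dbox_subset_sqBox _ _ hw
  have h2 : w ∈ sqBox (planar k q) (ρ + (2 * ρ + 3)) := mem_sqBox_add (GlueGeom.mem_sqBox_comm hz) h1
  exact sqBox_mono _ (by omega) h2

/-- **Every configuration of `𝒳` admits a local modification** (segment target), with cleared set
inside a box of radius `3ρ + 3`. [cite: NewmanTassionWu2017, §3.2 (proof of Theorem 3.7, the map Φ : 𝒳 → 𝔓(𝒳′))] -/
theorem exists_gadget_seg (hk : 1 ≤ k) (hρ : 4 ≤ ρ)
    (hsep : ∀ a' ∈ V.A, ∀ c' ∈ V.C, c' ∉ sqBox a' (4 * ρ + 8))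
    (hω : ω ⊆ (slabGraph 3 k).edgeSet) (hX : ω ∈ V.Q.evXn k ρ) :
    ∃ ω', GadgetSpec V.Q k (3 * ρ + 3) ω ω' := by
  obtain ⟨c₀, q, l, hc₀, hch, hnd, hsub, hhead, hnear, hfar⟩ := exists_contact hX
  have hX' : ω ∈ V.Q.evX k := hX.1
  by_cases hA' : ∃ a' ∈ V.A, a' ∈ sqBox (planar k q) (ρ + 3)
  · obtain ⟨dg, hdg⟩ := exists_directGlue_A_seg hω hX' hsep hc₀ hch hnd hsub hhead hA'
    exact ⟨_, GadgetSpec.of_directGlue_A (Q := V.Q) hX' dg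
      ⟨planar k q, hdg.trans (sqBox_mono _ (by omega))⟩⟩
  by_cases hC' : ∃ c' ∈ V.C, c' ∈ sqBox (planar k q) (ρ + 3)
  · obtain ⟨dg, hdg⟩ := exists_directGlue_C_seg hω hX' hsep hnear hC'
    exact ⟨_, GadgetSpec.of_directGlue_C (Q := V.Q) hX' dg ⟨planar k q, hdg⟩⟩
  push Not at hA' hC'
  by_cases hB : V.Bnear (planar k q) (V.R ρ (planar k q))
  · obtain ⟨sb, hsb⟩ := exists_surgeryB_near hk hρ hω hX' hc₀ hch hnd hsub hhead hnear hfar hA' hC' hB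
    exact ⟨_, GadgetSpec.of_surgeryB hX' sb ⟨planar k q, hsb.trans (sqBox_mono _ (by omega))⟩⟩
  · obtain ⟨sx, hsx⟩ := exists_surgery_noB hk (by omega) hω hX' hc₀ hch hnd hsub hhead hnear hfar hA' hC' hB
    exact ⟨_, GadgetSpec.of_surgery hX' sx ⟨planar k q, hsx.trans (sqBox_mono _ (by omega))⟩⟩

end Constructions

/-! ## GL0 in the linear regime with a segment target -/

section GL0

/-- **NTW 2017, Theorem 3.6 (GL0), linear regime, SEGMENT target**: in a rectangle
`S = [a,b] × [c,d]` of the slab `S_k` (`k ≥ 1`), with `B = {b} × [y₁, y₂]` (`y₁ < y₂`), `A, C ⊆ S`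
at sup-distance `> 4ρ + 8` (`ρ ≥ 4`), `D ⊆ S` arbitrary, under the planar-crossing hypothesis
for `(A, B, C, D)`: for `0 < p < 1`,
`P_p[A ⟷^S B] · P_p[C ⟷^S D] ≤ (1 + λ^s) · P_p[C ⟷^S A]`, `λ = 2/min{p, 1-p}`,
`s = 3(5k+4)(12ρ+13)²`. [cite: NewmanTassionWu2017, §3.2 (Theorem 3.6 with Remark 3: h₀(x) ≥ c₀ x)] -/
theorem glueLinear_seg (V : SegSetup) (hk : 1 ≤ k) {ρ : ℕ} (hρ : 4 ≤ ρ)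
    (hsep : ∀ a' ∈ V.A, ∀ c' ∈ V.C, c' ∉ sqBox a' (4 * ρ + 8)) {Dd : Set (ℤ × ℤ)}
    (hcross : PlanarCrossing V.S V.A V.B V.C Dd)
    (p : unitInterval) (hp0 : 0 < (p : ℝ)) (hp1 : (p : ℝ) < 1) :
    (bondPercolation (slabGraph 3 k) p).real (slabConn k V.S V.A V.B) *
        (bondPercolation (slabGraph 3 k) p).real (slabConn k V.S V.C Dd) ≤
      (1 + (2 / min (p : ℝ) (1 - p)) ^ (3 * ((5 * k + 4) * (2 * (2 * (3 * ρ + 3)) + 1) ^ 2))) *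
        (bondPercolation (slabGraph 3 k) p).real (slabConn k V.S V.C V.A) :=
  glueLinear_of_gadgets (Q := V.Q) (ρ := ρ) rfl hcross p hp0 hp1
    (fun _ hω hX => exists_gadget_seg hk hρ hsep hω hX)

/-- **GL0, linear regime, segment target, for crossings of a rectangle**: `A` on the left side,
`B = {b} × [y₁, y₂]` on the right side, `C` on the bottom side and `D` on the top side.
[cite: NewmanTassionWu2017, §3.2 (Theorem 3.6 with Remark 3; §3.3, Proposition 3.9's X, Y)] -/
theorem glueLinear_seg_rect (V : SegSetup) (hk : 1 ≤ k) {ρ : ℕ} (hρ : 4 ≤ ρ)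
    (hsep : ∀ a' ∈ V.A, ∀ c' ∈ V.C, c' ∉ sqBox a' (4 * ρ + 8))
    (hAl : ∀ z ∈ V.A, z.1 = V.a) (hCb : ∀ z ∈ V.C, z.2 = V.c) {Dd : Set (ℤ × ℤ)}
    (hDt : ∀ z ∈ Dd, z.2 = V.d) (p : unitInterval) (hp0 : 0 < (p : ℝ)) (hp1 : (p : ℝ) < 1) :
    (bondPercolation (slabGraph 3 k) p).real (slabConn k V.S V.A V.B) *
        (bondPercolation (slabGraph 3 k) p).real (slabConn k V.S V.C Dd) ≤
      (1 + (2 / min (p : ℝ) (1 - p)) ^ (3 * ((5 * k + 4) * (2 * (2 * (3 * ρ + 3)) + 1) ^ 2))) *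
        (bondPercolation (slabGraph 3 k) p).real (slabConn k V.S V.C V.A) :=
  glueLinear_seg V hk hρ hsep (planarCrossing_rect (a := V.a) (b := V.b) (c := V.c) (d := V.d)
    hAl (fun _ hz => hz.1) hCb hDt) p hp0 hp1

/-- The same with `C` on the top side and `D` on the bottom side.
[cite: NewmanTassionWu2017, §3.2 (Theorem 3.6 with Remark 3; §3.3)] -/
theorem glueLinear_seg_rect' (V : SegSetup) (hk : 1 ≤ k) {ρ : ℕ} (hρ : 4 ≤ ρ)
    (hsep : ∀ a' ∈ V.A, ∀ c' ∈ V.C, c' ∉ sqBox a' (4 * ρ + 8))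
    (hAl : ∀ z ∈ V.A, z.1 = V.a) (hCt : ∀ z ∈ V.C, z.2 = V.d) {Dd : Set (ℤ × ℤ)}
    (hDb : ∀ z ∈ Dd, z.2 = V.c) (p : unitInterval) (hp0 : 0 < (p : ℝ)) (hp1 : (p : ℝ) < 1) :
    (bondPercolation (slabGraph 3 k) p).real (slabConn k V.S V.A V.B) *
        (bondPercolation (slabGraph 3 k) p).real (slabConn k V.S V.C Dd) ≤
      (1 + (2 / min (p : ℝ) (1 - p)) ^ (3 * ((5 * k + 4) * (2 * (2 * (3 * ρ + 3)) + 1) ^ 2))) *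
        (bondPercolation (slabGraph 3 k) p).real (slabConn k V.S V.C V.A) :=
  glueLinear_seg V hk hρ hsep (planarCrossing_rect' (a := V.a) (b := V.b) (c := V.c) (d := V.d)
    hAl (fun _ hz => hz.1) hCt hDb) p hp0 hp1

end GL0

end NTW17

end Literature.Probability.Percolation
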